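import Literature.AlgebraicGeometry.Frobenioids.PadicFrobenioidPairIsoOrientation
import Literature.AnabelianGeometry.AbsoluteAnabelian.MonoAnalyticNonarchModel
import HarnessLib

/-!
# Frobenioids II, Thm. 2.4 (ii) for a GENERAL equivalence `Ψ`: the induced `K̄₁^× ⥲ K̄₂^×` IS the units transport of
# [AbsAnab] Prop. 1.2.1 — binder-free in the MLF structure (the `p`-adic valuation of `K = ℚ̄_p^G`)

Mochizuki, *The geometry of Frobenioids II*, Kyushu J. Math. **62** (2008) 401–460, §2, proof of Thm. 2.4, p. 20 ll. 21–27
[cite: MochizukiFrdII2008, Thm 2.4 (i) p.20] ("`Ψ` preserves «`O^▷(−)`» [cf. [Mzk5], Cor. 4.10, Cor. 4.11, (iii)]") and (ii), p. 20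
l.−5 – p. 21 l. 6 [cite: MochizukiFrdII2008, Thm 2.4 (ii) p.21] ("`Ψ` induces a pair of compatible isomorphisms `G₁ ⥲ G₂`;
`K̄₁^× ⥲ K̄₂^×` … we may apply [[AbsAnab], Prop. 1.2.1]").

PROOF-ONLY companion (cell abc-iut, `plan/L1/SUBDAG-FrdII-Thm24.md` row W12-L17 / residual (R2) of FrdII:Thm2.4(ii); seat
abc-iut-w5-d229), capstone of `PadicFrobenioidPairIsoOrientation`: its `exists_pairIso_absAnabChart_unitsTransport` is stated for
ANY MLF structure on the base fields `Kᵢ = ℚ̄_{pᵢ}^{Gᵢ}` whose integers are the `pᵢ`-adic ones (`hvᵢ`) and under "`Ψ_B` preserves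
effective divisors" (`hpos`).  Here both binders are discharged from tree material:
* §1 `PadicFrd.exists_divB_eq_of_of_square` — `hpos` from the divisor half of the row-L02 slot, i.e. a component
  `Ψ_Φ : Φ₁ ⟶ E^op ⋙ Φ₂` with `Div_B ∘ Ψ_B = Ψ_Φ^gp ∘ Div_B` ([FrdI] Cor. 4.11 (iii), "`Ψ` preserves the divisor map");
* §2 `valuation_le_one_iff_norm_le_one_subfield` — `hv` for the RESTRICTED `p`-adic valuation `PadicAlgCl.subfieldValuativeRel K`
  (abc-iut-L4, `GaloisPadicLogTower`; `PadicAlgCl.mem_integer_subfield_iff`), for which a finite `K ⊆ ℚ̄_p` is a Mathlib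
  non-archimedean local field (`PadicAlgCl.isNonarchimedeanLocalField_subfield`, `MonoAnalyticNonarchModel`);
* §3 `exists_pairIso_unitsTransport_padic` — **for fieldwise saturated `p`-adic Frobenioids over the genuine §2 bases and an
  equivalence `Ψ` given with `Ψ^Base = E`, `Ψ_B`, `Ψ_Φ` ([FrdI] Cor. 4.11 data): the `Ψ`-induced pair read in the [AbsAnab] chart of
  the `p`-adic local fields `Kᵢ` satisfies `IsAlphaEquivariant α ψ̄♮ ∧ PreservesAbsUnits ψ̄♮ ∧ PreservesUniformizers ψ̄♮`** — the
  complete Frobenioid-side input (R2) of W12's Thm. 2.4 (ii) closer (abc-iut-w5-d201 `exists_thm24ii_ofLocalField` / L2-t12),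
  whose only remaining junction is the identification of `α` with the Definition-2.2 context isomorphism's `isoG` (abc-iut-L1-t7).
Theorems only (no definitions); nothing here bears on [IUTchIII] Cor. 3.12.
-/

noncomputable section

namespace Literature.AlgebraicGeometry.Frobenioids

open CategoryTheory CategoryTheory.Limits Opposite Topology Filter Function ValuativeRel
open Literature.AnabelianGeometry.SemiGraphs Literature.AnabelianGeometry.AbsoluteAnabelian Field
open scoped ValuativeRel

/-! ### §1 "`Ψ` preserves `O^▷`" from the divisor half of the row-L02 slot ([FrdI] Cor. 4.11 (iii)) -/

namespace PadicFrd

variable {D₁ : Type} [Category D₁] {D₂ : Type} [Category D₂] {p₁ p₂ : ℕ} [Fact p₁.Prime] [Fact p₂.Prime]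
  (d₁ : Datum D₁ p₁) (d₂ : Datum D₂ p₂)

/-- **Effectivity is preserved** as soon as `Ψ_B : B₁ ≅ E^op ⋙ B₂` comes with a divisor component `Ψ_Φ : Φ₁ ⟶ E^op ⋙ Φ₂`
making the square `Div_B ∘ Ψ_B = Ψ_Φ^gp ∘ Div_B` commute on elements ([FrdI] Cor. 4.11 (iii): `Ψ` preserves the divisor
monoid and the divisor map): an element of `B₁(A)` with effective divisor goes to one with effective divisor — the hypothesis
`hpos` of `exists_pairIso_fbarUnits_integral`. [cite: MochizukiFrdII2008, Thm 2.4 (i) p.20] -/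
theorem exists_divB_eq_of_of_square (E : D₁ ≌ D₂) (ΨB : d₁.B ≅ E.functor.op ⋙ d₂.B) (ΨΦ : d₁.Φ ⟶ E.functor.op ⋙ d₂.Φ)
    (hsq : ∀ (A : D₁) (b : d₁.B.obj (op A)),
      Frobenioids.divB d₂.Φ d₂.B d₂.divB (op (E.functor.obj A)) (ΨB.hom.app (op A) b) =
        MonGp.map (ΨΦ.app (op A)).hom (Frobenioids.divB d₁.Φ d₁.B d₁.divB (op A) b))
    (A : D₁) (b : d₁.B.obj (op A)) (c : d₁.Φ.obj (op A))
    (h : Frobenioids.divB d₁.Φ d₁.B d₁.divB (op A) b = Algebra.GrothendieckGroup.of c) :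
    ∃ c₂ : d₂.Φ.obj (op (E.functor.obj A)),
      Frobenioids.divB d₂.Φ d₂.B d₂.divB (op (E.functor.obj A)) (ΨB.hom.app (op A) b) = Algebra.GrothendieckGroup.of c₂ :=
  ⟨(ΨΦ.app (op A)).hom c, by rw [hsq, h, MonGp.map_of]⟩

end PadicFrd

/-! ### §2 The `p`-adic MLF structure of `K = ℚ̄_p^G` has the `p`-adic integers -/

namespace BaseGaloisSystem

open QuasiTemperoid

section Subfield

variable {p : ℕ} [Fact p.Prime] (K : IntermediateField ℚ_[p] (Fbar ℚ_[p]))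

/-- For the valuative relation of the restricted `p`-adic absolute value on `K ⊆ ℚ̄_p`
(`PadicAlgCl.subfieldValuativeRel`, abc-iut-L4; the one for which a finite `K` is a Mathlib non-archimedean local field,
`PadicAlgCl.isNonarchimedeanLocalField_subfield`): `v(x) ≤ 1 ↔ ‖x‖ ≤ 1` in `ℚ̄_p`. [cite: MochizukiFrdII2008, Ex 1.1 (i) p.7] -/
theorem valuation_le_one_iff_norm_le_one_subfield (x : K) :
    letI := PadicAlgCl.subfieldValuativeRel K
    valuation K x ≤ 1 ↔ ‖((x : Fbar ℚ_[p]) : PadicAlgCl p)‖ ≤ 1 := by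
  letI := PadicAlgCl.subfieldValuativeRel K
  rw [← Valuation.mem_integer_iff, PadicAlgCl.mem_integer_subfield_iff]
  rfl

end Subfield

/-! ### §3 [FrdII] Thm. 2.4 (ii) for a general `Ψ`: the units transport, binder-free in the MLF structure -/

section Main

variable {p₁ p₂ : ℕ} [Fact p₁.Prime] [Fact p₂.Prime]
  {G : Type} [Group G] [TopologicalSpace G] [IsTopologicalGroup G] (hG : IsTempered G)
  {G₂ : Type} [Group G₂] [TopologicalSpace G₂] [IsTopologicalGroup G₂] (hG₂ : IsTempered G₂)
  (φ₁ : G →* GalFbar ℚ_[p₁]) (hφ₁ : IsOpenHom φ₁) (φ₂ : G₂ →* GalFbar ℚ_[p₂]) (hφ₂ : IsOpenHom φ₂)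
  (N : ℕ → OpenNormalSubgroup G) (hN : Antitone N)
  (d₁ : PadicFrd.Datum (CosetCat G) p₁) (d₂ : PadicFrd.Datum (CosetCat G₂) p₂)

include hG hG₂ hN in
/-- **[FrdII] Thm. 2.4 (ii), the Frobenioid-side input (R2) for a GENERAL equivalence `Ψ`, with the MLF structures of the base
fields THE `p`-adic ones.**  For fieldwise saturated `pᵢ`-adic Frobenioid data over the genuine §2 bases, `E = Ψ^Base` with the
row-L02 slots `Ψ_B : B₁ ≅ E^op ⋙ B₂` and a divisor component `Ψ_Φ : Φ₁ ⟶ E^op ⋙ Φ₂` with `Div_B ∘ Ψ_B = Ψ_Φ^gp ∘ Div_B` ([FrdI] Cor.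
4.11 (ii)(iii), "`Ψ` preserves `O^▷(−)`"), and a cofinal tower for `Π₁`; the base fields `Kᵢ = ℚ̄_{pᵢ}^{Gᵢ}` carrying the restricted
`pᵢ`-adic valuation and the subspace topology (`PadicAlgCl.subfieldValuativeRel`, a Mathlib non-archimedean local field by
`PadicAlgCl.isNonarchimedeanLocalField_subfield`): the pair induced by `Ψ`, read in the [AbsAnab] chart (`α`, `ψ̄♮`), satisfies
`IsAlphaEquivariant α ψ̄♮ ∧ PreservesAbsUnits ψ̄♮ ∧ PreservesUniformizers ψ̄♮` — `ψ̄♮` IS the units transport of [AbsAnab]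
Prop. 1.2.1 (vi)/(vii) for `α`, and `α` is `ψ : G₁ ⥲ G₂` through `galConjBase`.  Remaining named inputs: none on the
Frobenioid/valuation side; the identification of `α` with the Definition-2.2 context isomorphism's `isoG` is abc-iut-L1-t7's
chart. [cite: MochizukiFrdII2008, Thm 2.4 (ii) p.21] -/
theorem exists_pairIso_unitsTransport_padic
    (hd₁ : d₁.base = CosetCat.push φ₁ hφ₁.isOpenMap ⋙ CosetCat.toConnected (isTempered_galFbar ℚ_[p₁]) ⋙
      galoisPadicFields p₁)
    (hd₂ : d₂.base = CosetCat.push φ₂ hφ₂.isOpenMap ⋙ CosetCat.toConnected (isTempered_galFbar ℚ_[p₂]) ⋙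
      galoisPadicFields p₂)
    (hfs₁ : d₁.IsFieldwiseSaturated) (hfs₂ : d₂.IsFieldwiseSaturated)
    (E : CosetCat G ≌ CosetCat G₂) (ΨB : d₁.B ≅ E.functor.op ⋙ d₂.B) (ΨΦ : d₁.Φ ⟶ E.functor.op ⋙ d₂.Φ)
    (hsq : ∀ (A : CosetCat G) (b : d₁.B.obj (op A)),
      Frobenioids.divB d₂.Φ d₂.B d₂.divB (op (E.functor.obj A)) (ΨB.hom.app (op A) b) =
        MonGp.map (ΨΦ.app (op A)).hom (Frobenioids.divB d₁.Φ d₁.B d₁.divB (op A) b))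
    (hNb : ∀ U ∈ 𝓝 (1 : G), ∃ k, (N k : Set G) ⊆ U) :
    letI := PadicAlgCl.subfieldValuativeRel (PadicFrd.RelGal.baseFld p₁ φ₁ hφ₁)
    letI := PadicAlgCl.subfieldValuativeRel (PadicFrd.RelGal.baseFld p₂ φ₂ hφ₂)
    haveI := PadicFrd.RelGal.finiteDimensional_baseFld p₁ φ₁ hφ₁
    haveI := PadicFrd.RelGal.finiteDimensional_baseFld p₂ φ₂ hφ₂
    haveI := PadicAlgCl.isNonarchimedeanLocalField_subfield (PadicFrd.RelGal.baseFld p₁ φ₁ hφ₁)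
    haveI := PadicAlgCl.isNonarchimedeanLocalField_subfield (PadicFrd.RelGal.baseFld p₂ φ₂ hφ₂)
    ∃ (φ : G ≃ₜ* G₂) (ψ : φ₁.range ≃ₜ* φ₂.range) (ψbar : (Fbar ℚ_[p₁])ˣ ≃* (Fbar ℚ_[p₂])ˣ)
      (α : absoluteGaloisGroup (PadicFrd.RelGal.baseFld p₁ φ₁ hφ₁) ≃ₜ* absoluteGaloisGroup (PadicFrd.RelGal.baseFld p₂ φ₂ hφ₂))
      (ψn : (AlgebraicClosure (PadicFrd.RelGal.baseFld p₁ φ₁ hφ₁))ˣ ≃* (AlgebraicClosure (PadicFrd.RelGal.baseFld p₂ φ₂ hφ₂))ˣ),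
      φ₁.ker.map φ.toMulEquiv.toMonoidHom = φ₂.ker ∧
      (∀ g : G, (ψ ⟨φ₁ g, ⟨g, rfl⟩⟩ : GalFbar ℚ_[p₂]) = φ₂ (φ g)) ∧
      (∀ (σ : φ₁.range) (u : (Fbar ℚ_[p₁])ˣ),
        ψbar (Units.map ((σ : GalFbar ℚ_[p₁]) : Fbar ℚ_[p₁] →* Fbar ℚ_[p₁]) u) =
          Units.map (((ψ σ : φ₂.range) : GalFbar ℚ_[p₂]) : Fbar ℚ_[p₂] →* Fbar ℚ_[p₂]) (ψbar u)) ∧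
      (∀ τ : absoluteGaloisGroup (PadicFrd.RelGal.baseFld p₁ φ₁ hφ₁),
        ((PadicFrd.RelGal.galConjBase p₂ φ₂ hφ₂ (α τ) : ↥(PadicFrd.RelGal.baseFld p₂ φ₂ hφ₂).fixingSubgroup) :
            GalFbar ℚ_[p₂]) =
          (ψ ⟨(PadicFrd.RelGal.galConjBase p₁ φ₁ hφ₁ τ : ↥(PadicFrd.RelGal.baseFld p₁ φ₁ hφ₁).fixingSubgroup),
            MonoidHom.mem_range.mpr ((PadicFrd.RelGal.mem_fixingSubgroup_baseFld_iff p₁ φ₁ hφ₁ _).mp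
              (PadicFrd.RelGal.galConjBase p₁ φ₁ hφ₁ τ).2)⟩ : GalFbar ℚ_[p₂])) ∧
      (∀ y : (AlgebraicClosure (PadicFrd.RelGal.baseFld p₁ φ₁ hφ₁))ˣ,
        ((ψn y : (AlgebraicClosure (PadicFrd.RelGal.baseFld p₂ φ₂ hφ₂))ˣ) :
            AlgebraicClosure (PadicFrd.RelGal.baseFld p₂ φ₂ hφ₂)) =
          (PadicFrd.RelGal.closureEquiv p₂ φ₂ hφ₂).symm
            ((ψbar (Units.map ((PadicFrd.RelGal.closureEquiv p₁ φ₁ hφ₁ :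
              AlgebraicClosure (PadicFrd.RelGal.baseFld p₁ φ₁ hφ₁) ≃ₐ[PadicFrd.RelGal.baseFld p₁ φ₁ hφ₁] Fbar ℚ_[p₁]) :
                AlgebraicClosure (PadicFrd.RelGal.baseFld p₁ φ₁ hφ₁) →* Fbar ℚ_[p₁]) y) : (Fbar ℚ_[p₂])ˣ) :
              Fbar ℚ_[p₂])) ∧
      Prop121vii.IsAlphaEquivariant α ψn ∧ Prop121vii.PreservesAbsUnits ψn ∧ Prop121vii.PreservesUniformizers ψn := by
  letI := PadicAlgCl.subfieldValuativeRel (PadicFrd.RelGal.baseFld p₁ φ₁ hφ₁)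
  letI := PadicAlgCl.subfieldValuativeRel (PadicFrd.RelGal.baseFld p₂ φ₂ hφ₂)
  haveI := PadicFrd.RelGal.finiteDimensional_baseFld p₁ φ₁ hφ₁
  haveI := PadicFrd.RelGal.finiteDimensional_baseFld p₂ φ₂ hφ₂
  haveI := PadicAlgCl.isNonarchimedeanLocalField_subfield (PadicFrd.RelGal.baseFld p₁ φ₁ hφ₁)
  haveI := PadicAlgCl.isNonarchimedeanLocalField_subfield (PadicFrd.RelGal.baseFld p₂ φ₂ hφ₂)
  exact exists_pairIso_absAnabChart_unitsTransport hG hG₂ φ₁ hφ₁ φ₂ hφ₂ N hN d₁ d₂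
    (valuation_le_one_iff_norm_le_one_subfield _) (valuation_le_one_iff_norm_le_one_subfield _)
    hd₁ hd₂ hfs₁ hfs₂ E ΨB hNb (fun k b c h => PadicFrd.exists_divB_eq_of_of_square d₁ d₂ E ΨB ΨΦ hsq _ b c h)

end Main

/-! ### §4 Non-vacuity: the hypotheses are jointly satisfiable (`C₀|_D`, `Ψ = 𝟭`, `Ψ_B = 𝟙`, `Ψ_Φ = 𝟙`) -/

section NonVacuity

variable {p : ℕ} [Fact p.Prime] {G : Type} [Group G] [TopologicalSpace G] [IsTopologicalGroup G]
  [SecondCountableTopology G] (hG : IsTempered G) (φ₀ : G →* GalFbar ℚ_[p]) (hφ₀ : IsOpenHom φ₀)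

include hG hφ₀ in
/-- **Kernel instance over an arbitrary genuine base.**  For `Π` tempered and Galois-countable with an open `φ₀ : Π → G_{ℚ_p}`:
the datum `C₀|_D` (`PadicFrd.Datum.zero`), `Ψ^Base = 𝟭`, `Ψ_B = 𝟙`, `Ψ_Φ = 𝟙` (whose divisor square commutes trivially) meet
every hypothesis of `exists_pairIso_unitsTransport_padic`, so the [AbsAnab] units transport with its three properties EXISTS
for the `p`-adic local field `K = ℚ̄_p^{Im Π}`. [cite: MochizukiFrdII2008, Thm 2.4 (ii) p.21] -/
theorem exists_pairIso_unitsTransport_padic_zero :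
    letI := PadicAlgCl.subfieldValuativeRel (PadicFrd.RelGal.baseFld p φ₀ hφ₀)
    haveI := PadicFrd.RelGal.finiteDimensional_baseFld p φ₀ hφ₀
    haveI := PadicAlgCl.isNonarchimedeanLocalField_subfield (PadicFrd.RelGal.baseFld p φ₀ hφ₀)
    ∃ (φ : G ≃ₜ* G) (ψ : φ₀.range ≃ₜ* φ₀.range) (ψbar : (Fbar ℚ_[p])ˣ ≃* (Fbar ℚ_[p])ˣ)
      (α : absoluteGaloisGroup (PadicFrd.RelGal.baseFld p φ₀ hφ₀) ≃ₜ* absoluteGaloisGroup (PadicFrd.RelGal.baseFld p φ₀ hφ₀))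
      (ψn : (AlgebraicClosure (PadicFrd.RelGal.baseFld p φ₀ hφ₀))ˣ ≃* (AlgebraicClosure (PadicFrd.RelGal.baseFld p φ₀ hφ₀))ˣ),
      φ₀.ker.map φ.toMulEquiv.toMonoidHom = φ₀.ker ∧
      (∀ g : G, (ψ ⟨φ₀ g, ⟨g, rfl⟩⟩ : GalFbar ℚ_[p]) = φ₀ (φ g)) ∧
      (∀ (σ : φ₀.range) (u : (Fbar ℚ_[p])ˣ),
        ψbar (Units.map ((σ : GalFbar ℚ_[p]) : Fbar ℚ_[p] →* Fbar ℚ_[p]) u) =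
          Units.map (((ψ σ : φ₀.range) : GalFbar ℚ_[p]) : Fbar ℚ_[p] →* Fbar ℚ_[p]) (ψbar u)) ∧
      Prop121vii.IsAlphaEquivariant α ψn ∧ Prop121vii.PreservesAbsUnits ψn ∧ Prop121vii.PreservesUniformizers ψn := by
  obtain ⟨N, hN, hNb⟩ := exists_antitone_cofinal_seq hG
  let d : PadicFrd.Datum (CosetCat G) p :=
    PadicFrd.Datum.zero (CosetCat.push φ₀ hφ₀.isOpenMap ⋙ CosetCat.toConnected (isTempered_galFbar ℚ_[p]) ⋙
        galoisPadicFields p) (fun _ => isPadicLocal_galoisPadicFields p _) CosetCat.isConnected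
      CosetCat.isTotallyEpimorphic (isMonoprime_ordInt_genuine φ₀ hφ₀)
  obtain ⟨φ, ψ, ψbar, α, ψn, hker, hψ, hσ, -, -, heq, hu, hunif⟩ :=
    exists_pairIso_unitsTransport_padic hG hG φ₀ hφ₀ φ₀ hφ₀ N hN d d rfl rfl
      (PadicFrd.Datum.isFieldwiseSaturated_zero _ _ _ _ _) (PadicFrd.Datum.isFieldwiseSaturated_zero _ _ _ _ _)
      CategoryTheory.Equivalence.refl (Iso.refl _) (𝟙 _) (fun A b => by
        change _ = MonGp.map (MonoidHom.id _) _
        rw [MonGp.map_id]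
        rfl) hNb
  exact ⟨φ, ψ, ψbar, α, ψn, hker, hψ, hσ, heq, hu, hunif⟩

/-- **No-hypothesis kernel instance**: `Π = G_{ℚ_p}` (`isTempered_galFbar`, Galois-countable), `φ₀ = id`, `C₀`, `Ψ = 𝟭`.
[cite: MochizukiFrdII2008, Thm 2.4 (ii) p.21] -/
theorem exists_pairIso_unitsTransport_padic_zero_galQp (p : ℕ) [Fact p.Prime] :
    let hid : IsOpenHom (MonoidHom.id (GalFbar ℚ_[p])) := ⟨continuous_id, IsOpenMap.id⟩
    letI := PadicAlgCl.subfieldValuativeRel (PadicFrd.RelGal.baseFld p (MonoidHom.id (GalFbar ℚ_[p])) hid)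
    haveI := PadicFrd.RelGal.finiteDimensional_baseFld p (MonoidHom.id (GalFbar ℚ_[p])) hid
    haveI := PadicAlgCl.isNonarchimedeanLocalField_subfield (PadicFrd.RelGal.baseFld p (MonoidHom.id (GalFbar ℚ_[p])) hid)
    ∃ (φ : GalFbar ℚ_[p] ≃ₜ* GalFbar ℚ_[p])
      (ψ : (MonoidHom.id (GalFbar ℚ_[p])).range ≃ₜ* (MonoidHom.id (GalFbar ℚ_[p])).range)
      (ψbar : (Fbar ℚ_[p])ˣ ≃* (Fbar ℚ_[p])ˣ)
      (α : absoluteGaloisGroup (PadicFrd.RelGal.baseFld p (MonoidHom.id (GalFbar ℚ_[p])) hid) ≃ₜ*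
        absoluteGaloisGroup (PadicFrd.RelGal.baseFld p (MonoidHom.id (GalFbar ℚ_[p])) hid))
      (ψn : (AlgebraicClosure (PadicFrd.RelGal.baseFld p (MonoidHom.id (GalFbar ℚ_[p])) hid))ˣ ≃*
        (AlgebraicClosure (PadicFrd.RelGal.baseFld p (MonoidHom.id (GalFbar ℚ_[p])) hid))ˣ),
      (MonoidHom.id _).ker.map φ.toMulEquiv.toMonoidHom = (MonoidHom.id _).ker ∧
      (∀ g : GalFbar ℚ_[p], (ψ ⟨g, ⟨g, rfl⟩⟩ : GalFbar ℚ_[p]) = φ g) ∧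
      (∀ (σ : (MonoidHom.id (GalFbar ℚ_[p])).range) (u : (Fbar ℚ_[p])ˣ),
        ψbar (Units.map ((σ : GalFbar ℚ_[p]) : Fbar ℚ_[p] →* Fbar ℚ_[p]) u) =
          Units.map (((ψ σ : (MonoidHom.id (GalFbar ℚ_[p])).range) : GalFbar ℚ_[p]) : Fbar ℚ_[p] →* Fbar ℚ_[p]) (ψbar u)) ∧
      Prop121vii.IsAlphaEquivariant α ψn ∧ Prop121vii.PreservesAbsUnits ψn ∧ Prop121vii.PreservesUniformizers ψn :=
  haveI := secondCountableTopology_galFbar_padic p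
  exists_pairIso_unitsTransport_padic_zero (isTempered_galFbar ℚ_[p]) (MonoidHom.id _) ⟨continuous_id, IsOpenMap.id⟩

end NonVacuity

end BaseGaloisSystem

end Literature.AlgebraicGeometry.Frobenioids

end
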